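import Literature.NumberTheory.GaloisRepresentations.CoeffDAction
import Mathlib.RingTheory.Flat.Basic
import HarnessLib

/-!
# `D(ρ)` with coefficients commutes with extension of the coefficient field

Let `𝔅` be a period-ring datum (prime field `P`, invariants `F`), `E₀ ⊆ E` coefficient fields
(`P`-algebras) and `r₀ : Γ → GL_n(E₀)` a framed representation with base change `r` to `E`.
We PROVE the **descent of invariants**

* `coeffD_baseChange_eq_span` — `D(r) = E · ι(D(r₀))` inside `Eⁿ ⊗_P B`, where
  `ι : E₀ⁿ ⊗_P B → Eⁿ ⊗_P B` is the inclusion (`(Eⁿ ⊗_P B)^Γ = E ⊗_{E₀} (E₀ⁿ ⊗_P B)^Γ`);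
* `finrank_span_ι_eq` — `dim_E (E · ι(W)) = dim_{E₀} W` for every finite-dimensional
  `E₀`-subspace `W ⊆ E₀ⁿ ⊗_P B` (flatness of `E/E₀`);

from the generic `mem_span_of_forall_baseChange_eq`: for a vector space `N` over `E₀` with a
family of endomorphisms, the joint fixed points in `E ⊗_{E₀} N` are spanned over `E` by
`1 ⊗ (fixed points in N)` (expand in an `E₀`-basis of `E`), and the `Γ`- and `F`-equivariant
identification `Θ : E ⊗_{E₀} (E₀ⁿ ⊗_P B) ≃ Eⁿ ⊗_P B` (`Θ_tmul`, `Θ_baseChange_coeffTensorRep`,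
`Θ_baseChange_baseAct`).  This is the standard "`D_B` commutes with extension of coefficients"
(Fontaine's theory is `P`-linear; Patrikis 2019, §2.7.1; Buzzard–Gee §2.2).

No named facts, no `sorry`.

## References

* S. Patrikis, *Variations on a theorem of Tate*, Mem. AMS 258 (2019), §2.7.1. [Patrikis2019]
-/

noncomputable section

open TensorProduct Module Matrix

namespace Literature.NumberTheory.GaloisRepresentations

namespace PeriodRingData

universe u v v'

/-! ### Fixed points in a base change -/

section FixedPoints

open scoped Classical

variable {R S N : Type*} [Field R] [Field S] [Algebra R S] [AddCommGroup N] [Module R N]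

/-- Coordinates of `E ⊗_{E₀} N` in an `E₀`-basis of `E`. [folklore] -/
def baseChangeCoords : S ⊗[R] N ≃ₗ[R] (Basis.ofVectorSpaceIndex R S →₀ N) :=
  TensorProduct.congr (Basis.ofVectorSpace R S).repr (LinearEquiv.refl R N) ≪≫ₗ
    finsuppScalarLeft R N (Basis.ofVectorSpaceIndex R S)

/-- `baseChangeCoords` on pure tensors. [folklore] -/
theorem baseChangeCoords_tmul_apply (s : S) (x : N) (i : Basis.ofVectorSpaceIndex R S) :
    baseChangeCoords (s ⊗ₜ[R] x) i = (Basis.ofVectorSpace R S).repr s i • x := by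
  simp [baseChangeCoords]

/-- The inverse of `baseChangeCoords` on a single coordinate. [folklore] -/
theorem baseChangeCoords_symm_single (i : Basis.ofVectorSpaceIndex R S) (x : N) :
    (baseChangeCoords (R := R) (S := S) (N := N)).symm (Finsupp.single i x) = (Basis.ofVectorSpace R S i) ⊗ₜ[R] x := by
  rw [baseChangeCoords, LinearEquiv.trans_symm, LinearEquiv.trans_apply, finsuppScalarLeft_symm_apply_single,
    TensorProduct.congr_symm_tmul, LinearEquiv.refl_symm, LinearEquiv.refl_apply, Basis.repr_symm_single_one]

/-- The base change of an endomorphism acts coordinatewise. [folklore] -/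
theorem baseChangeCoords_baseChange (g : N →ₗ[R] N) (z : S ⊗[R] N) (i : Basis.ofVectorSpaceIndex R S) :
    baseChangeCoords (g.baseChange S z) i = g (baseChangeCoords z i) := by
  induction z using TensorProduct.induction_on with
  | zero => simp
  | tmul s x => rw [LinearMap.baseChange_tmul, baseChangeCoords_tmul_apply, baseChangeCoords_tmul_apply, map_smul]
  | add x y hx hy => simp only [map_add, Finsupp.add_apply, hx, hy]

/-- **Fixed points descend**: an element of `E ⊗_{E₀} N` fixed by the base changes of a family of
endomorphisms of `N` lies in the `E`-span of `1 ⊗ (joint fixed points in N)`. [folklore] -/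
theorem mem_span_of_forall_baseChange_eq (G : Set (N →ₗ[R] N)) {z : S ⊗[R] N} (hz : ∀ g ∈ G, g.baseChange S z = z) :
    z ∈ Submodule.span S ((fun x : N => (1 : S) ⊗ₜ[R] x) '' {x | ∀ g ∈ G, g x = x}) := by
  classical
  set c := baseChangeCoords (R := R) (S := S) (N := N) z with hc
  have hfix : ∀ i, ∀ g ∈ G, g (c i) = c i := fun i g hg => by
    rw [hc, ← baseChangeCoords_baseChange, hz g hg]
  have hz' : z = ∑ i ∈ c.support, (Basis.ofVectorSpace R S i) • ((1 : S) ⊗ₜ[R] c i) := by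
    conv_lhs => rw [← (baseChangeCoords (R := R) (S := S) (N := N)).symm_apply_apply z, ← hc, ← Finsupp.sum_single c]
    rw [Finsupp.sum, map_sum]
    refine Finset.sum_congr rfl fun i _ => ?_
    rw [baseChangeCoords_symm_single, TensorProduct.smul_tmul', smul_eq_mul, mul_one]
  rw [hz']
  exact Submodule.sum_mem _ fun i _ => Submodule.smul_mem _ _ (Submodule.subset_span ⟨c i, hfix i, rfl⟩)

/-- **Dimension of the span of a base-changed subspace**: `dim_E (E · (1 ⊗ W)) = dim_{E₀} W`. [folklore] -/
theorem finrank_span_one_tmul_image (W : Submodule R N) [FiniteDimensional R W] :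
    Module.finrank S (Submodule.span S ((fun x : N => (1 : S) ⊗ₜ[R] x) '' (W : Set N))) = Module.finrank R W := by
  have h1 : Submodule.span S ((fun x : N => (1 : S) ⊗ₜ[R] x) '' (W : Set N)) = W.baseChange S := by
    rw [Submodule.baseChange_eq_span, Submodule.map_coe]
    rfl
  rw [h1, Submodule.baseChange, LinearMap.finrank_range_of_inj, Module.finrank_baseChange]
  exact Module.Flat.lTensor_preserves_injective_linearMap _ W.injective_subtype

end FixedPoints

/-! ### Extension of the coefficient field of a framed representation -/

section Descent

-- Mathlib's own global value of `maxSynthPendingDepth` (see `LabelledWeightsTwist`); the large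
-- tensor types also need a higher instance-synthesis budget.
set_option maxSynthPendingDepth 3
set_option synthInstance.maxHeartbeats 100000

variable {Γ : Type u} [Group Γ] [TopologicalSpace Γ] {P : Type v} {F : Type v'} [Field P] [Field F] [Algebra P F]
  {E₀ E : Type*} [Field E₀] [Field E] [Algebra P E₀] [Algebra P E] [Algebra E₀ E] [IsScalarTower P E₀ E]
  [TopologicalSpace E₀] [TopologicalSpace E] [IsTopologicalRing E₀] [IsTopologicalRing E]
  (𝔅 : PeriodRingData.{u, v, v', _} Γ P F) (n : ℕ)

/-- **`Θ : E ⊗_{E₀} (E₀ⁿ ⊗_P B) ≃ Eⁿ ⊗_P B`**, `s ⊗ (m₀ ⊗ b) ↦ (m₀ · s) ⊗ b`. [folklore] -/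
def coeffExt : E ⊗[E₀] ((Fin n → E₀) ⊗[P] 𝔅.B) ≃ₗ[E] (Fin n → E) ⊗[P] 𝔅.B :=
  (AlgebraTensorModule.assoc P E₀ E E (Fin n → E₀) 𝔅.B).symm ≪≫ₗ
    AlgebraTensorModule.congr (TensorProduct.piScalarRight E₀ E E (Fin n)) (LinearEquiv.refl P 𝔅.B)

omit [TopologicalSpace Γ] [TopologicalSpace E₀] [TopologicalSpace E] [IsTopologicalRing E₀] [IsTopologicalRing E] in
/-- `coeffExt` on pure tensors. [folklore] -/
@[simp] theorem coeffExt_tmul (s : E) (m₀ : Fin n → E₀) (b : 𝔅.B) :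
    𝔅.coeffExt n (s ⊗ₜ[E₀] (m₀ ⊗ₜ[P] b)) = (fun i => m₀ i • s) ⊗ₜ[P] b := by
  simp [coeffExt]

/-- **The inclusion `ι : E₀ⁿ ⊗_P B → Eⁿ ⊗_P B`**, `x ↦ Θ(1 ⊗ x)`. [folklore] -/
def coeffIncl : (Fin n → E₀) ⊗[P] 𝔅.B →ₗ[E₀] (Fin n → E) ⊗[P] 𝔅.B :=
  ((𝔅.coeffExt n).toLinearMap.restrictScalars E₀) ∘ₗ TensorProduct.mk E₀ E ((Fin n → E₀) ⊗[P] 𝔅.B) 1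

omit [TopologicalSpace Γ] [TopologicalSpace E₀] [TopologicalSpace E] [IsTopologicalRing E₀] [IsTopologicalRing E] in
/-- `coeffIncl x = Θ (1 ⊗ x)`. [folklore] -/
theorem coeffIncl_apply (x : (Fin n → E₀) ⊗[P] 𝔅.B) : 𝔅.coeffIncl n x = 𝔅.coeffExt n ((1 : E) ⊗ₜ[E₀] x) := rfl

omit [TopologicalSpace Γ] [TopologicalSpace E₀] [TopologicalSpace E] [IsTopologicalRing E₀] [IsTopologicalRing E] in
/-- `coeffIncl` on pure tensors: apply `E₀ → E` to the coordinates. [folklore] -/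
theorem coeffIncl_tmul (m₀ : Fin n → E₀) (b : 𝔅.B) :
    𝔅.coeffIncl n (m₀ ⊗ₜ[P] b) = (fun i => algebraMap E₀ E (m₀ i)) ⊗ₜ[P] b := by
  rw [coeffIncl_apply, coeffExt_tmul]
  congr 1
  funext i
  rw [Algebra.smul_def, mul_one]

variable {n} (r₀ : FramedRep Γ E₀ n) (hc : Continuous (algebraMap E₀ E))

omit [TopologicalSpace Γ] [TopologicalSpace E₀] [TopologicalSpace E] [IsTopologicalRing E₀] [IsTopologicalRing E] in
/-- Matrix–vector products commute with `E₀ → E` (the scalar `s` pulled out). [folklore] -/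
theorem map_mulVec_smul (A : Matrix (Fin n) (Fin n) E₀) (m₀ : Fin n → E₀) (s : E) :
    (A.map (algebraMap E₀ E)) *ᵥ (fun i => m₀ i • s) = fun i => (A *ᵥ m₀) i • s := by
  funext i
  simp only [Matrix.mulVec, dotProduct, Matrix.map_apply, Algebra.smul_def, map_sum, map_mul, Finset.sum_mul]
  refine Finset.sum_congr rfl fun j _ => ?_
  ring

/-- **`Θ` is `Γ`-equivariant**: it intertwines the base change of the diagonal action of `r₀` with
the diagonal action of the base-changed representation. [folklore] -/
theorem coeffExt_baseChange_coeffTensorRep (σ : Γ) (z : E ⊗[E₀] ((Fin n → E₀) ⊗[P] 𝔅.B)) :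
    𝔅.coeffExt n (((𝔅.coeffTensorRep (FramedRep.toContinuousRep r₀) σ :
        (Fin n → E₀) ⊗[P] 𝔅.B →ₗ[E₀] (Fin n → E₀) ⊗[P] 𝔅.B)).baseChange E z) =
      𝔅.coeffTensorRep (FramedRep.toContinuousRep (r₀.baseChange (algebraMap E₀ E) hc)) σ (𝔅.coeffExt n z) := by
  induction z using TensorProduct.induction_on with
  | zero => simp
  | tmul s y =>
    induction y using TensorProduct.induction_on with
    | zero => simp
    | tmul m₀ b =>
      rw [LinearMap.baseChange_tmul, coeffTensorRep_apply_tmul, FramedRep.toContinuousRep_apply_apply, coeffExt_tmul,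
        coeffExt_tmul, coeffTensorRep_apply_tmul, FramedRep.toContinuousRep_apply_apply, FramedRep.baseChange_apply]
      congr 1
      exact (map_mulVec_smul _ m₀ s).symm
    | add x y hx hy => rw [tmul_add, map_add, map_add, hx, hy, map_add, map_add]
  | add x y hx hy => rw [map_add, map_add, hx, hy, map_add, map_add]

omit [TopologicalSpace Γ] [TopologicalSpace E₀] [TopologicalSpace E] [IsTopologicalRing E₀] [IsTopologicalRing E] in
/-- **`Θ` is `F`-equivariant** (`baseAct`). [folklore] -/
theorem coeffExt_baseChange_baseAct (f : F) (z : E ⊗[E₀] ((Fin n → E₀) ⊗[P] 𝔅.B)) :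
    𝔅.coeffExt n ((𝔅.baseAct E₀ (Fin n → E₀) f).baseChange E z) = 𝔅.baseAct E (Fin n → E) f (𝔅.coeffExt n z) := by
  induction z using TensorProduct.induction_on with
  | zero => simp
  | tmul s y =>
    induction y using TensorProduct.induction_on with
    | zero => simp
    | tmul m₀ b => rw [LinearMap.baseChange_tmul, baseAct_tmul, coeffExt_tmul, coeffExt_tmul, baseAct_tmul]
    | add x y hx hy => rw [tmul_add, map_add, map_add, hx, hy, map_add, map_add]
  | add x y hx hy => rw [map_add, map_add, hx, hy, map_add, map_add]

/-- `ι` is `Γ`-equivariant. [folklore] -/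
theorem coeffIncl_coeffTensorRep (σ : Γ) (x : (Fin n → E₀) ⊗[P] 𝔅.B) :
    𝔅.coeffIncl n (𝔅.coeffTensorRep (FramedRep.toContinuousRep r₀) σ x) =
      𝔅.coeffTensorRep (FramedRep.toContinuousRep (r₀.baseChange (algebraMap E₀ E) hc)) σ (𝔅.coeffIncl n x) := by
  rw [coeffIncl_apply, coeffIncl_apply, ← coeffExt_baseChange_coeffTensorRep, LinearMap.baseChange_tmul]

omit [TopologicalSpace Γ] [TopologicalSpace E₀] [TopologicalSpace E] [IsTopologicalRing E₀] [IsTopologicalRing E] in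
/-- `ι` is `F`-equivariant. [folklore] -/
theorem coeffIncl_baseAct (f : F) (x : (Fin n → E₀) ⊗[P] 𝔅.B) :
    𝔅.coeffIncl n (𝔅.baseAct E₀ (Fin n → E₀) f x) = 𝔅.baseAct E (Fin n → E) f (𝔅.coeffIncl n x) := by
  rw [coeffIncl_apply, coeffIncl_apply, ← coeffExt_baseChange_baseAct, LinearMap.baseChange_tmul]

/-- **`D` commutes with extension of coefficients**: `D(r) = E · ι(D(r₀))` in `Eⁿ ⊗_P B` for the
base change `r` of `r₀ : Γ → GL_n(E₀)` to `E ⊇ E₀`. [cite: Patrikis2019, §2.7.1] -/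
theorem coeffD_baseChange_eq_span :
    𝔅.coeffD (FramedRep.toContinuousRep (r₀.baseChange (algebraMap E₀ E) hc)) =
      Submodule.span E (𝔅.coeffIncl n '' (𝔅.coeffD (FramedRep.toContinuousRep r₀) : Set ((Fin n → E₀) ⊗[P] 𝔅.B))) := by
  refine le_antisymm ?_ ?_
  · intro x hx
    set z := (𝔅.coeffExt (E₀ := E₀) (E := E) n).symm x with hzdef
    have hxz : x = 𝔅.coeffExt n z := by rw [hzdef, LinearEquiv.apply_symm_apply]
    let G : Set ((Fin n → E₀) ⊗[P] 𝔅.B →ₗ[E₀] (Fin n → E₀) ⊗[P] 𝔅.B) :=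
      Set.range fun σ => (𝔅.coeffTensorRep (FramedRep.toContinuousRep r₀) σ :
        (Fin n → E₀) ⊗[P] 𝔅.B →ₗ[E₀] (Fin n → E₀) ⊗[P] 𝔅.B)
    have hz : ∀ g ∈ G, g.baseChange E z = z := by
      rintro _ ⟨σ, rfl⟩
      apply (𝔅.coeffExt n).injective
      rw [coeffExt_baseChange_coeffTensorRep, ← hxz]
      exact hx σ
    have hmem := mem_span_of_forall_baseChange_eq G hz
    have hfixed : {y : (Fin n → E₀) ⊗[P] 𝔅.B | ∀ g ∈ G, g y = y} = (𝔅.coeffD (FramedRep.toContinuousRep r₀) : Set _) := by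
      ext y
      simp only [Set.mem_setOf_eq, SetLike.mem_coe, mem_coeffD_iff, G, Set.forall_mem_range]
    rw [hfixed] at hmem
    have himage := Submodule.mem_map_of_mem (f := (𝔅.coeffExt n).toLinearMap) hmem
    rw [Submodule.map_span, ← Set.image_comp] at himage
    rw [hxz]
    exact himage
  · rw [Submodule.span_le]
    rintro _ ⟨y, hy, rfl⟩ σ
    rw [← coeffIncl_coeffTensorRep, (mem_coeffD_iff _ _ _).1 hy σ]

omit [TopologicalSpace Γ] [TopologicalSpace E₀] [TopologicalSpace E] [IsTopologicalRing E₀] [IsTopologicalRing E] in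
/-- **Dimension of `E · ι(W)`**: `dim_E (E · ι(W)) = dim_{E₀} W`. [folklore] -/
theorem finrank_span_coeffIncl_image (W : Submodule E₀ ((Fin n → E₀) ⊗[P] 𝔅.B)) [FiniteDimensional E₀ W] :
    Module.finrank E (Submodule.span E (𝔅.coeffIncl (E := E) n '' (W : Set ((Fin n → E₀) ⊗[P] 𝔅.B)))) =
      Module.finrank E₀ W := by
  have h1 : Submodule.span E (𝔅.coeffIncl (E := E) n '' (W : Set ((Fin n → E₀) ⊗[P] 𝔅.B))) =
      (Submodule.span E ((fun x => (1 : E) ⊗ₜ[E₀] x) '' (W : Set ((Fin n → E₀) ⊗[P] 𝔅.B)))).map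
        (𝔅.coeffExt n).toLinearMap := by
    rw [Submodule.map_span, ← Set.image_comp]
    rfl
  rw [h1, LinearEquiv.finrank_map_eq]
  exact finrank_span_one_tmul_image W

end Descent

end PeriodRingData

end Literature.NumberTheory.GaloisRepresentations

end
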